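/-
Origin: expansion seat `prover-pub-hodgecm-mc-sinst-1-g11-0`, handover #1274 2026-08-21T04:13Z md5 54a5e6ec3f05 (172 l.; NEW additive leaf; imports #1273 + carch-1 #CA73 ArchKTypeOfCentralWeightR234; § 0 ns HodgeCM.Model.ThetaAdelicSide: adelicCharZeroG_eq_lineCharV_zero ∕ adelicCharOne_eq_lineCharV_one ∕ adelicCharTwoG_eq_lineCharV_two ∕ adelicCharThree_eq_lineCharV_three (rfl: sinst-1's adelic V-characters ARE carch's lineCharV_k); § 1 ns HodgeCM.Model.SInstance, at S := SROGT'C … V c under hc : GOG V c: isAutChar_char{Zero,One,Two,Three}DictG_ROGT'C_of_archWeight hc χ (hχw : ∀ t, χ(♯(t,1_f)) · archWeight L (μ c k) t = 1) : (splitLine_kTwistedG …).IsAutChar (char_kDictG … χ) := isAutChar_char_kDictG_of_weight at w := archWeight L (μ c k), hw := carch #CA72∕#CA73 archWeight_mul_lineCharV_k_eq_torusScalar_ROGT'C hc — the four slot dictionary characters are GoodChars at the pin of record FOR EVERY χ OF ARCHIMEDEAN TYPE −μ c k (the slot's weight set), NO archimedean hypothesis left; cert rc 0 ∕ 38 s;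 #print axioms 8 ∕ 8 ⊆ trio; NAMES for audit: HodgeCM.Model.ThetaAdelicSide.adelicCharOne_eq_lineCharV_one · HodgeCM.Model.SInstance.isAutChar_charZeroDictG_ROGT'C_of_archWeight · HodgeCM.Model.SInstance.isAutChar_charOneDictG_ROGT'C_of_archWeight) (`HOME/mc/pub-hodgecm-mc-sinst-1-g11/stage72/HodgeCM/Model/AdelicThetaSlotPinsROGTCWeight.lean`, md5 54a5e6ec3f05, 172 lines);
landed by the second packager p2 gen 18 (p2-g18) in gate run 72 as `HodgeCM/Model/AdelicThetaSlotPinsROGTCWeight.lean` (verbatim).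
-/
/-
Copyright (c) 2026 the pub-hodgecm formalisation cell (harness21).  New file, not vendored.
Origin: session prover-pub-hodgecm-mc-sinst-1-g11-0 (unit pub-hodgecm-mc-sinst-1-g11, S-INSTANCE CONSTRUCTOR gen 11; the SEAM-AUT of the four slot
dictionary characters AT THE PIN OF RECORD `SInstance.SROGT'C` with the archimedean identity DISCHARGED: carch-1's hypothesis-free (Hw_k′)
`archWeight_mul_lineCharV_k_eq_torusScalar_ROGT'C` (#CA72 ∕ #CA73) is literally the `hw` of sinst-1's `isAutChar_char…DictG_of_weight`, since
`ThetaAdelicSide.adelicChar_k = ArchSideTerm.lineCharV_k` by `rfl`), 2026-08-21.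
Intended final place: `HodgeCM/Model/AdelicThetaSlotPinsROGTCWeight.lean` (NEW additive model-layer leaf; imports sinst-1 #1273
`Model/AdelicThetaSlotPinsROGTC` and carch-1 #CA73 `Model/ArchKTypeOfCentralWeightR234` (⊇ #CA72 `…R2`); nothing imports it; drop alone).
-/
import Summits.HodgeConjecture.HodgeCM.Model.AdelicThetaSlotPinsROGTC
import Summits.HodgeConjecture.HodgeCM.Model.ArchKTypeOfCentralWeightR234_2

set_option autoImplicit false

/-!
# `IsAutChar` of the four slot dictionary characters at the pin of record, ON THE WEIGHT SET, hypothesis-free under the OG guard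

§ 0 `adelicCharZeroG ∕ adelicCharOne ∕ adelicCharTwoG ∕ adelicCharThree … η_k = ArchSideTerm.lineCharV_zero ∕ one ∕ two ∕ three … η_k` (`rfl`:
sinst-1's adelic `V`-character of slot `k` and carch-1's `V`-part of the line scalar are the same term).
§ 1 At `S := SROGT'C @hGR @hGR₀ @hGR₁ @hGR₂ @hGR₃ @μ hΔ₁ hΔ₂ hΔ₃ V c` under `hc : GOG V c`, for each slot `k` and every unitary character `χ`
of `[L¹]` whose ARCHIMEDEAN TYPE IS THE SLOT WEIGHT — `hχw : ∀ t, χ(♯(t,1_f)) · archWeight L (μ c k) t = 1` (the weight set of the slot sum) —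
**`isAutChar_char…DictG_ROGT'C_of_archWeight hc χ hχw : (splitLine_kTwistedG …).IsAutChar (char_kDictG … χ)`**: sinst-1
`isAutChar_char…DictG_of_weight` at `w := archWeight L (μ c k)` with `hw :=` carch-1 `archWeight_mul_lineCharV_k_eq_torusScalar_ROGT'C hc`.
No archimedean hypothesis is left: binder-2's `hχ` socket input for the (J3) dictionary at the pin of record is a THEOREM on the weight set.
KERNEL only: 0 records, 0 `def … : Prop`, nothing cited as a hypothesis; `#print axioms` ⊆ {propext, Classical.choice, Quot.sound}.
-/

noncomputable section

open MulAction IsDedekindDomain NumberField.mixedEmbedding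
open NumberField hiding relNormOneIdeles relNormOneRat probHaarRelNormOneQuot relNormOneInfUnits relNormOneInfToIdeles
open scoped Matrix TensorProduct Classical SchwartzMap
open Literature.NumberTheory.Automorphic Literature.NumberTheory.Weil1964
open Literature.NumberTheory.GelbartRogawski1991 Literature.NumberTheory.GelbartRogawski1991.UnitaryDualPair
open Literature.AlgebraicGeometry.ShimuraVarieties
open HodgeCM.Adelic HodgeCM.PerL34 HodgeCM.Model.ArchSideTerm HodgeCM.Model.ThetaDistFin HodgeCM.Model.ThetaAdelicSide
open Literature.NumberTheory.Automorphic.UnitaryGroup (cmAdelicOneEquivRelNormOne)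

namespace HodgeCM.Model

/-! ## § 0. sinst-1's adelic `V`-characters ARE carch-1's `lineCharV_k` (`rfl`) -/

namespace ThetaAdelicSide

variable {L : CMField} {ι₁ : L →+* ℂ} (V : HermSpace3 L ι₁) (c : SeesawCtx L)
  (hGR : (cmSplittingDatum (L : Type) finProdFinEquiv (frameD V) (frameD_real V) (frameD_ne V) (dW c.D) (dW_real c.D)
    (dW_ne c.D)).CompatibleSplitting)
  (hGR₀ : (cmSplittingDatum (L : Type) (e₁) (frameD V) (frameD_real V) (frameD_ne V) (lineVec (L : Type) (dW c.D 0))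
    (fun _ => dW_real c.D 0) (fun _ => dW_ne c.D 0)).CompatibleSplitting)
  (hGR₁ : (cmSplittingDatum (L : Type) (e₁) (frameD V) (frameD_real V) (frameD_ne V) (lineVec (L : Type) (dW c.D 1))
    (fun _ => dW_real c.D 1) (fun _ => dW_ne c.D 1)).CompatibleSplitting)
  (hGR₂ : (cmSplittingDatum (L : Type) (e₁) (frameD V) (frameD_real V) (frameD_ne V) (lineVec (L : Type) (dW' c.D 0))
    (fun _ => dW'_real c.D 0) (fun _ => dW'_ne c.D 0)).CompatibleSplitting)
  (hGR₃ : (cmSplittingDatum (L : Type) (e₁) (frameD V) (frameD_real V) (frameD_ne V) (lineVec (L : Type) (dW' c.D 1))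
    (fun _ => dW'_real c.D 1) (fun _ => dW'_ne c.D 1)).CompatibleSplitting)
  (η₀ η₁ η₂ η₃ : CMAdelic (L : Type) (frameD V) × CMAdelicOne (L : Type) →* ℂˣ)

/-- (Ported verbatim from the HodgeCMPerL package; no docstring in the source.) -/
theorem adelicCharZeroG_eq_lineCharV_zero : adelicCharZeroG V c hGR hGR₀ hGR₁ η₀ = lineCharV_zero V c.D hGR hGR₀ hGR₁ η₀ := rfl

/-- (Ported verbatim from the HodgeCMPerL package; no docstring in the source.) -/
theorem adelicCharOne_eq_lineCharV_one : adelicCharOne V c hGR hGR₀ hGR₁ η₁ = lineCharV_one V c.D hGR hGR₀ hGR₁ η₁ := rfl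

/-- (Ported verbatim from the HodgeCMPerL package; no docstring in the source.) -/
theorem adelicCharTwoG_eq_lineCharV_two : adelicCharTwoG V c hGR hGR₂ hGR₃ η₂ = lineCharV_two V c.D hGR hGR₂ hGR₃ η₂ := rfl

/-- (Ported verbatim from the HodgeCMPerL package; no docstring in the source.) -/
theorem adelicCharThree_eq_lineCharV_three : adelicCharThree V c hGR hGR₂ hGR₃ η₃ = lineCharV_three V c.D hGR hGR₂ hGR₃ η₃ := rfl

end ThetaAdelicSide

/-! ## § 1. At the pin of record: `IsAutChar` on the weight set, no archimedean hypothesis -/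

namespace SInstance

variable
  (hGR : ∀ {L : CMField} {ι₁ : L →+* ℂ} (V : HermSpace3 L ι₁) (c : SeesawCtx L),
    (cmSplittingDatum (L : Type) finProdFinEquiv (frameD V) (frameD_real V) (frameD_ne V) (dW c.D) (dW_real c.D)
      (dW_ne c.D)).CompatibleSplitting)
  (hGR₀ : ∀ {L : CMField} {ι₁ : L →+* ℂ} (V : HermSpace3 L ι₁) (c : SeesawCtx L),
    (cmSplittingDatum (L : Type) (e₁) (frameD V) (frameD_real V) (frameD_ne V) (lineVec (L : Type) (dW c.D 0))
      (fun _ => dW_real c.D 0) (fun _ => dW_ne c.D 0)).CompatibleSplitting)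
  (hGR₁ : ∀ {L : CMField} {ι₁ : L →+* ℂ} (V : HermSpace3 L ι₁) (c : SeesawCtx L),
    (cmSplittingDatum (L : Type) (e₁) (frameD V) (frameD_real V) (frameD_ne V) (lineVec (L : Type) (dW c.D 1))
      (fun _ => dW_real c.D 1) (fun _ => dW_ne c.D 1)).CompatibleSplitting)
  (hGR₂ : ∀ {L : CMField} {ι₁ : L →+* ℂ} (V : HermSpace3 L ι₁) (c : SeesawCtx L),
    (cmSplittingDatum (L : Type) (e₁) (frameD V) (frameD_real V) (frameD_ne V) (lineVec (L : Type) (dW' c.D 0))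
      (fun _ => dW'_real c.D 0) (fun _ => dW'_ne c.D 0)).CompatibleSplitting)
  (hGR₃ : ∀ {L : CMField} {ι₁ : L →+* ℂ} (V : HermSpace3 L ι₁) (c : SeesawCtx L),
    (cmSplittingDatum (L : Type) (e₁) (frameD V) (frameD_real V) (frameD_ne V) (lineVec (L : Type) (dW' c.D 1))
      (fun _ => dW'_real c.D 1) (fun _ => dW'_ne c.D 1)).CompatibleSplitting)
  (μ : ∀ {L : CMField}, SeesawCtx L → Fin 4 → NumberField.InfinitePlace (L : Type) → ℤ)
  (hΔ₁ : ∀ {L : CMField} {ι₁ : L →+* ℂ} (V : HermSpace3 L ι₁) (c : SeesawCtx L), ∀ hc : GOG V c,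
    slotTypeVec V c (hGR V c) (hGR₀ V c) (hGR₁ V c) (hGR₂ V c) (hGR₃ V c) (hG_GOG V c hc) 1 -
      slotTypeVec V c (hGR V c) (hGR₀ V c) (hGR₁ V c) (hGR₂ V c) (hGR₃ V c) (hG_GOG V c hc) 0 = μ c 1 - μ c 0)
  (hΔ₂ : ∀ {L : CMField} {ι₁ : L →+* ℂ} (V : HermSpace3 L ι₁) (c : SeesawCtx L), ∀ hc : GOG V c,
    slotTypeVec V c (hGR V c) (hGR₀ V c) (hGR₁ V c) (hGR₂ V c) (hGR₃ V c) (hG_GOG V c hc) 2 -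
      slotTypeVec V c (hGR V c) (hGR₀ V c) (hGR₁ V c) (hGR₂ V c) (hGR₃ V c) (hG_GOG V c hc) 0 = μ c 2 - μ c 0)
  (hΔ₃ : ∀ {L : CMField} {ι₁ : L →+* ℂ} (V : HermSpace3 L ι₁) (c : SeesawCtx L), ∀ hc : GOG V c,
    slotTypeVec V c (hGR V c) (hGR₀ V c) (hGR₁ V c) (hGR₂ V c) (hGR₃ V c) (hG_GOG V c hc) 3 -
      slotTypeVec V c (hGR V c) (hGR₀ V c) (hGR₁ V c) (hGR₂ V c) (hGR₃ V c) (hG_GOG V c hc) 0 = μ c 3 - μ c 0)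
  {L : CMField} {ι₁ : L →+* ℂ} (V : HermSpace3 L ι₁) (c : SeesawCtx L) (hc : GOG V c)

include hΔ₁ hΔ₂ hΔ₃ hc in
/-- **SLOT 0: `χ″₀` IS A `GoodChar` OF THE TWISTED SLOT-0 RECORD AT THE PIN OF RECORD FOR EVERY `χ` OF ARCHIMEDEAN TYPE `−μ c 0`**
(`hχw`), hypothesis-free under the guard: `hw :=` carch-1 (Hw₀′) `archWeight_mul_lineCharV_zero_eq_torusScalar_ROGT'C hc`. -/
theorem isAutChar_charZeroDictG_ROGT'C_of_archWeight
    (χ : PontryaginDual (↥(relNormOneIdeles (↥(maximalRealSubfield L)) L) ⧸ relNormOneRat (↥(maximalRealSubfield L)) L))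
    (hχw : ∀ t : ↥(relNormOneInfUnits (↥(maximalRealSubfield L)) L),
      ((χ (QuotientGroup.mk (relNormOneInfToIdeles (↥(maximalRealSubfield L)) L t)) : Circle) : ℂ) *
          Literature.NumberTheory.Automorphic.archWeight (L : Type) (μ c 0) t = 1) :
    (splitLineZeroTwistedG V c (hGR V c) (hGR₀ V c) (hGR₁ V c) (etaT₀ V c.D (EtaChi.η (@χVR @hGR @hGR₀ @hGR₁) (@χWR @hGR @hGR₀ @hGR₁ @μ) V c) (νR @hGR₁ V c)) (etaT₀_V_rat V c (EtaChi.η (@χVR @hGR @hGR₀ @hGR₁) (@χWR @hGR @hGR₀ @hGR₁ @μ) V c) (EtaChi.hη (@χVR @hGR @hGR₀ @hGR₁) (@χWR @hGR @hGR₀ @hGR₁ @μ) V c) (νR @hGR₁ V c) (hνR @hGR₁ V c))).IsAutChar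
      (charZeroDictG V c (hGR V c) (hGR₀ V c) (hGR₁ V c) (etaT₀ V c.D (EtaChi.η (@χVR @hGR @hGR₀ @hGR₁) (@χWR @hGR @hGR₀ @hGR₁ @μ) V c) (νR @hGR₁ V c)) χ) :=
  isAutChar_charZeroDictG_of_weight V c (hGR V c) (hGR₀ V c) (hGR₁ V c) (etaT₀ V c.D (EtaChi.η (@χVR @hGR @hGR₀ @hGR₁) (@χWR @hGR @hGR₀ @hGR₁ @μ) V c) (νR @hGR₁ V c))
    (continuous_etaT₀ V c.D (EtaChi.η (@χVR @hGR @hGR₀ @hGR₁) (@χWR @hGR @hGR₀ @hGR₁ @μ) V c) (νR @hGR₁ V c) (EtaChi.hηc (@χVR @hGR @hGR₀ @hGR₁) (@χWR @hGR @hGR₀ @hGR₁ @μ) V c) (hνcR @hGR₁ V c))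
    (etaT₀_V_rat V c (EtaChi.η (@χVR @hGR @hGR₀ @hGR₁) (@χWR @hGR @hGR₀ @hGR₁ @μ) V c) (EtaChi.hη (@χVR @hGR @hGR₀ @hGR₁) (@χWR @hGR @hGR₀ @hGR₁ @μ) V c) (νR @hGR₁ V c) (hνR @hGR₁ V c))
    (etaT₀_W_rat V c (EtaChi.η (@χVR @hGR @hGR₀ @hGR₁) (@χWR @hGR @hGR₀ @hGR₁ @μ) V c) (EtaChi.hη (@χVR @hGR @hGR₀ @hGR₁) (@χWR @hGR @hGR₀ @hGR₁ @μ) V c) (νR @hGR₁ V c) (hνR @hGR₁ V c)) (hG_GOG V c hc) χ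
    (fun t => Literature.NumberTheory.Automorphic.archWeight (L : Type) (μ c 0) t) hχw
    (fun t => archWeight_mul_lineCharV_zero_eq_torusScalar_ROGT'C @hGR @hGR₀ @hGR₁ @hGR₂ @hGR₃ @μ hΔ₁ hΔ₂ hΔ₃ V c hc t)

include hΔ₁ hΔ₂ hΔ₃ hc in
/-- **SLOT 1: `χ″₁` IS A `GoodChar` OF THE TWISTED SLOT-1 RECORD AT THE PIN OF RECORD FOR EVERY `χ` OF ARCHIMEDEAN TYPE `−μ c 1`**
(`hχw`), hypothesis-free under the guard: `hw :=` carch-1 (Hw₁′) `archWeight_mul_lineCharV_one_eq_torusScalar_ROGT'C hc`. -/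
theorem isAutChar_charOneDictG_ROGT'C_of_archWeight
    (χ : PontryaginDual (↥(relNormOneIdeles (↥(maximalRealSubfield L)) L) ⧸ relNormOneRat (↥(maximalRealSubfield L)) L))
    (hχw : ∀ t : ↥(relNormOneInfUnits (↥(maximalRealSubfield L)) L),
      ((χ (QuotientGroup.mk (relNormOneInfToIdeles (↥(maximalRealSubfield L)) L t)) : Circle) : ℂ) *
          Literature.NumberTheory.Automorphic.archWeight (L : Type) (μ c 1) t = 1) :
    (splitLineOneTwistedG V c (hGR V c) (hGR₀ V c) (hGR₁ V c) (etaT₁ V c.D (EtaChi.η (@χVR @hGR @hGR₀ @hGR₁) (@χWR @hGR @hGR₀ @hGR₁ @μ) V c) (νR @hGR₁ V c)) (etaT₁_V_rat V c (EtaChi.η (@χVR @hGR @hGR₀ @hGR₁) (@χWR @hGR @hGR₀ @hGR₁ @μ) V c) (νR @hGR₁ V c) (hνR @hGR₁ V c))).IsAutChar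
      (charOneDictG V c (hGR V c) (hGR₀ V c) (hGR₁ V c) (etaT₁ V c.D (EtaChi.η (@χVR @hGR @hGR₀ @hGR₁) (@χWR @hGR @hGR₀ @hGR₁ @μ) V c) (νR @hGR₁ V c)) χ) :=
  isAutChar_charOneDictG_of_weight V c (hGR V c) (hGR₀ V c) (hGR₁ V c) (etaT₁ V c.D (EtaChi.η (@χVR @hGR @hGR₀ @hGR₁) (@χWR @hGR @hGR₀ @hGR₁ @μ) V c) (νR @hGR₁ V c))
    (continuous_etaT₁ V c.D (EtaChi.η (@χVR @hGR @hGR₀ @hGR₁) (@χWR @hGR @hGR₀ @hGR₁ @μ) V c) (νR @hGR₁ V c) (EtaChi.hηc (@χVR @hGR @hGR₀ @hGR₁) (@χWR @hGR @hGR₀ @hGR₁ @μ) V c) (hνcR @hGR₁ V c))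
    (etaT₁_V_rat V c (EtaChi.η (@χVR @hGR @hGR₀ @hGR₁) (@χWR @hGR @hGR₀ @hGR₁ @μ) V c) (νR @hGR₁ V c) (hνR @hGR₁ V c))
    (etaT₁_W_rat V c (EtaChi.η (@χVR @hGR @hGR₀ @hGR₁) (@χWR @hGR @hGR₀ @hGR₁ @μ) V c) (EtaChi.hη (@χVR @hGR @hGR₀ @hGR₁) (@χWR @hGR @hGR₀ @hGR₁ @μ) V c) (νR @hGR₁ V c) (hνR @hGR₁ V c)) (hG_GOG V c hc) χ
    (fun t => Literature.NumberTheory.Automorphic.archWeight (L : Type) (μ c 1) t) hχw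
    (fun t => archWeight_mul_lineCharV_one_eq_torusScalar_ROGT'C @hGR @hGR₀ @hGR₁ @hGR₂ @hGR₃ @μ hΔ₁ hΔ₂ hΔ₃ V c hc t)

include hΔ₁ hΔ₂ hΔ₃ hc in
/-- **SLOT 2: `χ″₂` IS A `GoodChar` OF THE TWISTED SLOT-2 RECORD AT THE PIN OF RECORD FOR EVERY `χ` OF ARCHIMEDEAN TYPE `−μ c 2`**
(`hχw`), hypothesis-free under the guard: `hw :=` carch-1 (Hw₂′) `archWeight_mul_lineCharV_two_eq_torusScalar_ROGT'C hc`. -/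
theorem isAutChar_charTwoDictG_ROGT'C_of_archWeight
    (χ : PontryaginDual (↥(relNormOneIdeles (↥(maximalRealSubfield L)) L) ⧸ relNormOneRat (↥(maximalRealSubfield L)) L))
    (hχw : ∀ t : ↥(relNormOneInfUnits (↥(maximalRealSubfield L)) L),
      ((χ (QuotientGroup.mk (relNormOneInfToIdeles (↥(maximalRealSubfield L)) L t)) : Circle) : ℂ) *
          Literature.NumberTheory.Automorphic.archWeight (L : Type) (μ c 2) t = 1) :
    (splitLineTwoTwistedG V c (hGR V c) (hGR₂ V c) (hGR₃ V c) (etaT₂ V c.D (EtaChi.η (@χVR @hGR @hGR₀ @hGR₁) (@χWR @hGR @hGR₀ @hGR₁ @μ) V c) (ν'R @hGR₃ V c)) (etaT₂_V_rat V c (EtaChi.η (@χVR @hGR @hGR₀ @hGR₁) (@χWR @hGR @hGR₀ @hGR₁ @μ) V c) (EtaChi.hη (@χVR @hGR @hGR₀ @hGR₁) (@χWR @hGR @hGR₀ @hGR₁ @μ) V c) (ν'R @hGR₃ V c) (hν'R @hGR₃ V c))).IsAutChar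
      (charTwoDictG V c (hGR V c) (hGR₂ V c) (hGR₃ V c) (etaT₂ V c.D (EtaChi.η (@χVR @hGR @hGR₀ @hGR₁) (@χWR @hGR @hGR₀ @hGR₁ @μ) V c) (ν'R @hGR₃ V c)) χ) :=
  isAutChar_charTwoDictG_of_weight V c (hGR V c) (hGR₂ V c) (hGR₃ V c) (etaT₂ V c.D (EtaChi.η (@χVR @hGR @hGR₀ @hGR₁) (@χWR @hGR @hGR₀ @hGR₁ @μ) V c) (ν'R @hGR₃ V c))
    (continuous_etaT₂ V c.D (EtaChi.η (@χVR @hGR @hGR₀ @hGR₁) (@χWR @hGR @hGR₀ @hGR₁ @μ) V c) (ν'R @hGR₃ V c) (EtaChi.hηc (@χVR @hGR @hGR₀ @hGR₁) (@χWR @hGR @hGR₀ @hGR₁ @μ) V c) (hν'cR @hGR₃ V c))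
    (etaT₂_V_rat V c (EtaChi.η (@χVR @hGR @hGR₀ @hGR₁) (@χWR @hGR @hGR₀ @hGR₁ @μ) V c) (EtaChi.hη (@χVR @hGR @hGR₀ @hGR₁) (@χWR @hGR @hGR₀ @hGR₁ @μ) V c) (ν'R @hGR₃ V c) (hν'R @hGR₃ V c))
    (etaT₂_W_rat V c (EtaChi.η (@χVR @hGR @hGR₀ @hGR₁) (@χWR @hGR @hGR₀ @hGR₁ @μ) V c) (EtaChi.hη (@χVR @hGR @hGR₀ @hGR₁) (@χWR @hGR @hGR₀ @hGR₁ @μ) V c) (ν'R @hGR₃ V c) (hν'R @hGR₃ V c)) (hG_GOG V c hc) χ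
    (fun t => Literature.NumberTheory.Automorphic.archWeight (L : Type) (μ c 2) t) hχw
    (fun t => archWeight_mul_lineCharV_two_eq_torusScalar_ROGT'C @hGR @hGR₀ @hGR₁ @hGR₂ @hGR₃ @μ hΔ₁ hΔ₂ hΔ₃ V c hc t)

include hΔ₁ hΔ₂ hΔ₃ hc in
/-- **SLOT 3: `χ″₃` IS A `GoodChar` OF THE TWISTED SLOT-3 RECORD AT THE PIN OF RECORD FOR EVERY `χ` OF ARCHIMEDEAN TYPE `−μ c 3`**
(`hχw`), hypothesis-free under the guard: `hw :=` carch-1 (Hw₃′) `archWeight_mul_lineCharV_three_eq_torusScalar_ROGT'C hc`. -/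
theorem isAutChar_charThreeDictG_ROGT'C_of_archWeight
    (χ : PontryaginDual (↥(relNormOneIdeles (↥(maximalRealSubfield L)) L) ⧸ relNormOneRat (↥(maximalRealSubfield L)) L))
    (hχw : ∀ t : ↥(relNormOneInfUnits (↥(maximalRealSubfield L)) L),
      ((χ (QuotientGroup.mk (relNormOneInfToIdeles (↥(maximalRealSubfield L)) L t)) : Circle) : ℂ) *
          Literature.NumberTheory.Automorphic.archWeight (L : Type) (μ c 3) t = 1) :
    (splitLineThreeTwistedG V c (hGR V c) (hGR₂ V c) (hGR₃ V c) (etaT₃ V c.D (EtaChi.η (@χVR @hGR @hGR₀ @hGR₁) (@χWR @hGR @hGR₀ @hGR₁ @μ) V c) (ν'R @hGR₃ V c)) (etaT₃_V_rat V c (EtaChi.η (@χVR @hGR @hGR₀ @hGR₁) (@χWR @hGR @hGR₀ @hGR₁ @μ) V c) (ν'R @hGR₃ V c) (hν'R @hGR₃ V c))).IsAutChar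
      (charThreeDictG V c (hGR V c) (hGR₂ V c) (hGR₃ V c) (etaT₃ V c.D (EtaChi.η (@χVR @hGR @hGR₀ @hGR₁) (@χWR @hGR @hGR₀ @hGR₁ @μ) V c) (ν'R @hGR₃ V c)) χ) :=
  isAutChar_charThreeDictG_of_weight V c (hGR V c) (hGR₂ V c) (hGR₃ V c) (etaT₃ V c.D (EtaChi.η (@χVR @hGR @hGR₀ @hGR₁) (@χWR @hGR @hGR₀ @hGR₁ @μ) V c) (ν'R @hGR₃ V c))
    (continuous_etaT₃ V c.D (EtaChi.η (@χVR @hGR @hGR₀ @hGR₁) (@χWR @hGR @hGR₀ @hGR₁ @μ) V c) (ν'R @hGR₃ V c) (EtaChi.hηc (@χVR @hGR @hGR₀ @hGR₁) (@χWR @hGR @hGR₀ @hGR₁ @μ) V c) (hν'cR @hGR₃ V c))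
    (etaT₃_V_rat V c (EtaChi.η (@χVR @hGR @hGR₀ @hGR₁) (@χWR @hGR @hGR₀ @hGR₁ @μ) V c) (ν'R @hGR₃ V c) (hν'R @hGR₃ V c))
    (etaT₃_W_rat V c (EtaChi.η (@χVR @hGR @hGR₀ @hGR₁) (@χWR @hGR @hGR₀ @hGR₁ @μ) V c) (EtaChi.hη (@χVR @hGR @hGR₀ @hGR₁) (@χWR @hGR @hGR₀ @hGR₁ @μ) V c) (ν'R @hGR₃ V c) (hν'R @hGR₃ V c)) (hG_GOG V c hc) χ
    (fun t => Literature.NumberTheory.Automorphic.archWeight (L : Type) (μ c 3) t) hχw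
    (fun t => archWeight_mul_lineCharV_three_eq_torusScalar_ROGT'C @hGR @hGR₀ @hGR₁ @hGR₂ @hGR₃ @μ hΔ₁ hΔ₂ hΔ₃ V c hc t)

end SInstance

end HodgeCM.Model

end
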